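import Summits.RiemannHypothesis.RiemannHypothesis.Theses.WeilComb
import Literature.NumberTheory.LFunctions.UniformWeilPositivityRH
import Literature.NumberTheory.LFunctions.WeilGroundEnergyProofs

/-!
# `WeilComb.CombSubcritical` (Theorem A, item stmt-RiemannHypothesis-1025): the small models `M ≤ 1`

Small-model fact for the crux `CombSubcritical` of route `RiemannHypothesis/WeilComb` (refuter /
cdisprove seat; helper file, supports 1025; no new definitions).

`weilComb_combSubcritical_upto_one`: the crux RESTRICTED TO `M ≤ 1` holds with the explicit window
`c₀ = (log 2)/2`.  `M = 0`: the comb is the zero function and `Q(0) = 0` (`weilQuadratic_zero`).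
`M = 1`: the comb `x ↦ a 1 · ε⁻¹ φ(x/ε)` is one Weil test supported in `[-ε, ε]` with
`ε ≤ (log 2)/2`, i.e. Yoshida's proved rung `weilPositivityOn_of_le_log_two_half`.

Consequently the first instance of Theorem A outside every in-tree positivity theorem is `M = 2`
(support `[-ε, log 2 + ε]`, width `> log 2`, not reducible to Yoshida's cone by translation), and any
universal `c₀` is decided in the small-`M` / large-`ε` corner `ε = c₀/M`, `M = 2, 3, …` as much as
in the large-`M` regime (numerics on the item).
-/

noncomputable section

open scoped BigOperators ComplexConjugate ContDiff
open Complex MeasureTheory Set Filter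

namespace Summit.RiemannHypothesis.RiemannHypothesis.Theorems

open Literature.NumberTheory.LFunctions
open Summit.RiemannHypothesis.RiemannHypothesis.Theses.WeilComb

/-- **Small models of Theorem A.** For every Weil test `φ` with `tsupport φ ⊆ [-1,1]`, every
`ε > 0`, every `M ≤ 1` and every `a`, if `ε·M ≤ (log 2)/2` then the comb
`x ↦ Σ_{m=1}^{M} a m · ε⁻¹ φ((x − log m)/ε)` has `Re Q ≥ 0` — the crux `CombSubcritical` restricted to
`M ≤ 1`, with the explicit `c₀ = (log 2)/2` (`M = 0`: `Q(0) = 0`; `M = 1`: Yoshida's rung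
`weilPositivityOn_of_le_log_two_half` on `[-ε, ε]`). [folklore] -/
theorem weilComb_combSubcritical_upto_one :
    ∀ φ : ℝ → ℂ, IsWeilTest φ → tsupport φ ⊆ Set.Icc (-1) 1 →
      ∀ ε : ℝ, 0 < ε → ∀ (M : ℕ) (a : ℕ → ℂ), M ≤ 1 → ε * M ≤ Real.log 2 / 2 →
        0 ≤ (weilQuadratic (fun x : ℝ => ∑ m ∈ Finset.Icc 1 M,
          a m * ((ε : ℂ)⁻¹ * φ ((x - Real.log (m : ℝ)) / ε)))).re := by
  intro φ hφ hsupp ε hε M a hM hwin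
  interval_cases M
  · have e : (fun x : ℝ => ∑ m ∈ Finset.Icc 1 0,
        a m * ((ε : ℂ)⁻¹ * φ ((x - Real.log (m : ℝ)) / ε))) = 0 := by
      funext x; simp
    rw [e, weilQuadratic_zero]; simp
  · have hε1 : ε ≤ Real.log 2 / 2 := by simpa using hwin
    have hφε : IsWeilTest fun x : ℝ => φ (x / ε) := by
      refine ⟨hφ.1.comp (contDiff_id.div_const ε), ?_⟩
      have h := hφ.2.comp_homeomorph (affineHomeomorph ε⁻¹ 0 (inv_ne_zero hε.ne'))
      convert h using 1
      funext x
      simp only [Function.comp_apply, affineHomeomorph_apply]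
      congr 1
      ring
    have ht : IsWeilTest fun x : ℝ => a 1 * ((ε : ℂ)⁻¹ * φ (x / ε)) :=
      (hφε.const_mul _).const_mul _
    have e : (fun x : ℝ => ∑ m ∈ Finset.Icc 1 1,
        a m * ((ε : ℂ)⁻¹ * φ ((x - Real.log (m : ℝ)) / ε))) =
          fun x : ℝ => a 1 * ((ε : ℂ)⁻¹ * φ (x / ε)) := by
      funext x; simp
    rw [e]
    have h2 : tsupport (fun x : ℝ => φ (x / ε)) ⊆ Set.Icc (-ε) ε := by
      refine closure_minimal ?_ isClosed_Icc
      intro x hx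
      have hx' : φ (x / ε) ≠ 0 := hx
      have hmem : x / ε ∈ Set.Icc (-1 : ℝ) 1 := hsupp (subset_tsupport _ hx')
      rw [Set.mem_Icc] at hmem ⊢
      constructor
      · have h := hmem.1; rw [le_div_iff₀ hε] at h; linarith
      · have h := hmem.2; rw [div_le_iff₀ hε] at h; linarith
    have h1 : tsupport (fun x : ℝ => a 1 * ((ε : ℂ)⁻¹ * φ (x / ε))) ⊆ Set.Icc (-ε) ε := by
      refine (tsupport_mul_subset_right :
        tsupport ((fun _ : ℝ => a 1) * fun x : ℝ => (ε : ℂ)⁻¹ * φ (x / ε)) ⊆ _).trans ?_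
      exact (tsupport_mul_subset_right :
        tsupport ((fun _ : ℝ => (ε : ℂ)⁻¹) * fun x : ℝ => φ (x / ε)) ⊆ _).trans h2
    exact weilPositivityOn_of_le_log_two_half hε1 _ ht h1

end Summit.RiemannHypothesis.RiemannHypothesis.Theorems

end
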